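import Literature.Computability.FineGrained.Sweep1
import HarnessLib

/-!
# Fine-grained sweep 1, companion: status of `ethr2_lower_bound_of_seth` and the one-model form
of Williams' win-win corollary (fine-grained.S26)

Companion to `Literature.Computability.FineGrained.Sweep1` (R. Williams, *The Orthogonal Vectors
Conjecture and Non-Uniform Circuit Lower Bounds*, FOCS 2024, pp. 1372–1387; full version
ECCC TR24-142 (2024); all locators below refer to the ECCC full version).

## What the source prints

* Abstract: "at least one of the following holds: • There is an `ε > 0` such that for infinitely
  many `n`, read-once 2-DNFs on `n` variables cannot be simulated by non-uniform `2^{εn}`-size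
  depth-two exact threshold circuits. […] • For every `c ≥ 1` and every `ε > 0`, Orthogonal
  Vectors on `n` vectors in `c log n` dimensions can be solved in `n^{1+ε}` uniform deterministic
  time. This case would provide a strong refutation of the Orthogonal Vectors conjecture, and of
  SETH: for example, CNF-SAT on `n` variables and `O(n)` clauses could be solved in `2^{n/2+o(n)}`
  time." This disjunction is the statement file's named fact
  `ethr2_lower_bound_or_ov_almost_linear` (`EThr2LowerBound ∨ OVAlmostLinear`; both disjuncts are
  registered OPEN statements of the statement file, `[status: open]`).
* §1, Hypothesis 1 (SETH): "For every constant `δ > 0`, there is a constant `k ≥ 3` such that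
  `k`-SAT cannot be solved in `2^{(1-δ)n}` time" — a hypothesis about (deterministic) *algorithms*
  (§1: "if SETH is false for deterministic algorithms, the algorithm's existence would resolve
  some non-uniform circuit lower bound problems").
* §1, Thm. 2 (an `ETHR ∘ ETHR` circuit of size `s` for `f` gives weak equality rank `≤ s + 1` for
  `¬M_f`), Thm. 3 ("Suppose there is a subexponential function `f(d)` such that for all `d`,
  `DISJ_d` has weak equality rank at most `f(d)`. Then for every `c ≥ 1` and every `ε > 0`, OV on
  `n` vectors in `c log n` dimensions can be solved in `n^{1+ε}` deterministic time. (As a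
  consequence, `k`-SAT can be solved in `2^{n/2+o(n)}` deterministic time, for all constants
  `k`.)"), and §4, proof of Cor. 1, case 1: "By the fine-grained reduction from CNF-SAT to OV
  [Wil04, WY14], this implies that CNF-SAT on `cn` clauses and `n` variables can be solved in
  `2^{n/2+εn}` time".

So the printed route from alternative (2) to "SETH is false" is Thm. 3 followed by the
split-and-list reduction of R. Williams, TCS 348 (2005), §5.1 — an implication between
*algorithms* in one machine model (the word RAM of fine-grained complexity, VVW ICM 2018, §2), which
in this tree reads: `OVAlmostLinear` refutes `OVConjectureDet`
(`not_ovConjectureDet_of_ovAlmostLinear`, proved in the statement file), hence refutes *word-RAM*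
SETH `SETHWordRAM` through the named fact `ovConjectureDet_of_sethWordRAM` (fine-grained.S09,
Williams 2005, Thm. 5.1) — `not_sethWordRAM_of_ovAlmostLinear` below.

## Status of `ethr2_lower_bound_of_seth` (mis-stated: cross-model hypothesis; deprecated 2026-08-15)

The statement file's `ethr2_lower_bound_of_seth : SETH → EThr2LowerBound` takes Wave0's
*multi-stack Turing-machine* `SETH` (`KSATInExpTime`, `Turing.FinTM2`) as hypothesis, and its
interim proof went through the named fact `ovConjectureDet_of_seth` (`SETH → OVConjectureDet`),
which was retired on 2026-08-14 as *misstated* for exactly this reason (`SETHHardness` module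
docstring, "Retired"; `OVFromSETH.ovConjectureDet_of_seth_of_bridge`): turning a fast *word-RAM*
OV (hence `k`-SAT) algorithm into a fast *Turing-machine* `k`-SAT algorithm at SETH granularity
needs a subpolynomial-overhead simulation of random-access machines by multitape machines, which
is not known (Cook–Reckhow, JCSS 7 (1973), §2: polynomial overhead). `ethr2_lower_bound_of_seth`
inherits the gap verbatim: it is the printed corollary PLUS the open machine-model bridge
`SETH → SETHWordRAM` (`ethr2_lower_bound_of_seth_of_bridge`), equivalently it asserts that failure
of the `ETHR ∘ ETHR` lower bound would refute *Turing-machine* SETH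
(`ethr2_lower_bound_of_seth_iff`), which the source does not claim. Note that the source itself
gives "evidence from SAT/SMT solvers that the first item […] may be false in its full generality"
(abstract): in that scenario word-RAM SETH fails, while nothing printed bears on Turing-machine
SETH, so the cross-model statement is not merely unproved but unsupported.

The CORRECTED, one-model statement is `SETHWordRAM → EThr2LowerBound`; being a composition of two
named facts already in the tree (the S26 disjunction and S09), it is *proved* here outright modulo
those names (`eThr2LowerBound_of_sethWordRAM`) rather than vendored as a further named fact.
Verdict clean-up 2026-08-15: the statement file's def `ethr2_lower_bound_of_seth` is now
`@[deprecated]` (mis-stated record, corrected as `eThr2LowerBound_of_sethWordRAM`), and the four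
records below that say what it asserts beyond print are stated over the explicit proposition
`SETH → EThr2LowerBound` — *definitionally* the deprecated def — so that no deprecated name is
referenced: the cross-model proposition is the printed facts plus the bridge
(`ethr2_lower_bound_of_seth_of_bridge`), it is at least as strong as the one-model form
(`sethWordRAM_form_of_ethr2_lower_bound_of_seth`, via the easy bridge `seth_of_sethWordRAM`, proved
as `SETHHardnessProofs.seth_of_sethWordRAM_holds`), its contrapositive reading
(`ethr2_lower_bound_of_seth_iff`), and the trivial case (`ethr2_lower_bound_of_seth_of_eThr2LowerBound`).
The interim proof of the sibling corollary `ethr2_lower_bound_of_ovConjectureDet` (demoted to a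
named fact by the M5 import) is restored as the assembly `ethr2_lower_bound_of_ovConjectureDet_of`.
What remains for unconditional versions: `ethr2_lower_bound_or_ov_almost_linear_holds` (Thms. 2, 3,
8, 10 of the source over the word RAM of the prelude) and `ovConjectureDet_of_sethWordRAM_holds`
(decomposed in `OVFromSETH.lean`).

## References

* R. Williams, *The Orthogonal Vectors Conjecture and Non-Uniform Circuit Lower Bounds*, FOCS 2024,
  1372–1387, doi:10.1109/focs61266.2024.00088; full version ECCC TR24-142: abstract, §1
  (Hypothesis 1, Thms. 2–3, Cor. 1), §3 (Thms. 8, 10, proof of Thm. 3), §4 (proof of Cor. 1).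
* R. Williams, *A new algorithm for optimal 2-constraint satisfaction and its implications*,
  Theoret. Comput. Sci. 348 (2005) 357–365, §5.1, Thm. 5.1.
* V. Vassilevska Williams, *On some fine-grained questions in algorithms and complexity*,
  Proc. ICM 2018, §2 (word RAM), §3 (Hypothesis 1, Thm. 3.1).
* S. A. Cook, R. A. Reckhow, *Time bounded random access machines*, JCSS 7 (1973), §2.
-/

namespace Literature.Computability.FineGrained

/-! ### The win-win corollaries in the machine model of the source -/

/-- **fine-grained.S26, assembly** (R. Williams, FOCS 2024 / ECCC TR24-142, abstract and §4,
Cor. 1: "OV-conjecture type hypotheses imply non-uniform circuit lower bounds"). The win-win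
disjunction `ethr2_lower_bound_or_ov_almost_linear` yields the corollary
`ethr2_lower_bound_of_ovConjectureDet` (`OVConjectureDet → EThr2LowerBound`): alternative (2),
`OVAlmostLinear`, contradicts the deterministic OV conjecture
(`not_ovConjectureDet_of_ovAlmostLinear`). This is the interim proof of the statement file,
restored as an assembly from the named fact. [cite: WilliamsFOCS2024, abstract and §4 Cor. 1] -/
theorem ethr2_lower_bound_of_ovConjectureDet_of (h : ethr2_lower_bound_or_ov_almost_linear) :
    ethr2_lower_bound_of_ovConjectureDet :=
  fun hOV => h.resolve_right fun h' => not_ovConjectureDet_of_ovAlmostLinear h' hOV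

/-- **Alternative (2) refutes SETH, in the model of the source** (R. Williams, ECCC TR24-142,
abstract: "This case would provide a strong refutation of the Orthogonal Vectors conjecture, and
of SETH"; §1 Thm. 3: "As a consequence, `k`-SAT can be solved in `2^{n/2+o(n)}` deterministic
time"; §4, proof of Cor. 1, case 1, via "the fine-grained reduction from CNF-SAT to OV [Wil04]").
Given the word-RAM theorem SETH ⇒ OVC (`ovConjectureDet_of_sethWordRAM`, Williams 2005, Thm. 5.1),
`OVAlmostLinear` refutes word-RAM SETH. [cite: WilliamsFOCS2024, §1 Thm. 3; §4 proof of Cor. 1 (case 1)] -/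
theorem not_sethWordRAM_of_ovAlmostLinear (h₂ : ovConjectureDet_of_sethWordRAM)
    (h : OVAlmostLinear) : ¬ SETHWordRAM :=
  fun hS => not_ovConjectureDet_of_ovAlmostLinear h (h₂ hS)

/-- **fine-grained.S26, corrected form of the deprecated `ethr2_lower_bound_of_seth`**
(R. Williams, FOCS 2024 / ECCC TR24-142, abstract: alternative (2) refutes SETH; with R. Williams,
TCS 348 (2005), Thm. 5.1). *Word-RAM* SETH implies the depth-two exact threshold lower bound for
read-once 2-DNFs: there is `ε > 0` such that for infinitely many `m` the read-once 2-DNF on `2m`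
variables has no `ETHR ∘ ETHR` circuit of size `2^{ε · 2m}` (`EThr2LowerBound`). Hypothesis and
conclusion are in the one machine model of the sources; proved from the two named facts in print,
the win-win disjunction `ethr2_lower_bound_or_ov_almost_linear` and `ovConjectureDet_of_sethWordRAM`.
The statement file's deprecated `ethr2_lower_bound_of_seth` (Turing-machine `SETH` as hypothesis)
is this statement plus the open bridge `SETH → SETHWordRAM` (`ethr2_lower_bound_of_seth_of_bridge`).
[cite: WilliamsFOCS2024, abstract (alternative (2) refutes SETH) and §4 Cor. 1] -/
theorem eThr2LowerBound_of_sethWordRAM (h₁ : ethr2_lower_bound_or_ov_almost_linear)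
    (h₂ : ovConjectureDet_of_sethWordRAM) (hS : SETHWordRAM) : EThr2LowerBound :=
  ethr2_lower_bound_of_ovConjectureDet_of h₁ (h₂ hS)

/-! ### What separates the cross-model `SETH → EThr2LowerBound` from print

The four records below are stated over the explicit proposition `SETH → EThr2LowerBound`, which
is definitionally the statement file's deprecated def `ethr2_lower_bound_of_seth` (verdict
clean-up 2026-08-15). -/

/-- The cross-model statement `SETH → EThr2LowerBound` (the deprecated
`ethr2_lower_bound_of_seth`: Wave0's Turing-machine SETH as hypothesis) follows from the two
printed facts together with the machine-model bridge `SETH → SETHWordRAM` ("a `2^{(1-ε)n}`-time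
word-RAM algorithm for `k`-SAT yields a `2^{(1-ε')n} · poly(L)`-time multi-stack Turing machine"),
which would require a subpolynomial-overhead simulation of random-access machines by multitape
Turing machines and is not known (Cook–Reckhow, JCSS 7 (1973), §2 give polynomial overhead).
Recorded to pin down exactly what the cross-model statement asserts beyond the source. [folklore] -/
theorem ethr2_lower_bound_of_seth_of_bridge (hbridge : SETH → SETHWordRAM)
    (h₁ : ethr2_lower_bound_or_ov_almost_linear) (h₂ : ovConjectureDet_of_sethWordRAM) :
    SETH → EThr2LowerBound :=
  fun hSETH => eThr2LowerBound_of_sethWordRAM h₁ h₂ (hbridge hSETH)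

/-- Conversely, the cross-model statement `SETH → EThr2LowerBound` is at least as strong as the
corrected one-model form: given the easy bridge `seth_of_sethWordRAM : SETHWordRAM → SETH` (a fast
Turing machine is a fast word RAM; proved as `seth_of_sethWordRAM_holds` in
`SETHHardnessProofs.lean`), it implies `SETHWordRAM → EThr2LowerBound`. [folklore] -/
theorem sethWordRAM_form_of_ethr2_lower_bound_of_seth (hconv : seth_of_sethWordRAM)
    (h : SETH → EThr2LowerBound) (hS : SETHWordRAM) : EThr2LowerBound :=
  h (hconv hS)

/-- What the cross-model statement `SETH → EThr2LowerBound` asserts, contrapositively: if the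
depth-two exact threshold lower bound for read-once 2-DNFs fails (alternative (1) of the win-win
theorem is false, a possibility for which the source itself offers SAT/SMT-solver evidence), then
*Turing-machine* SETH is false — whereas the source concludes only that SETH for (word-RAM)
algorithms is false. [folklore] -/
theorem ethr2_lower_bound_of_seth_iff :
    (SETH → EThr2LowerBound) ↔ (¬ EThr2LowerBound → ¬ SETH) :=
  ⟨fun h hlb hS => hlb (h hS), fun h hS => Classical.by_contradiction fun hlb => h hlb hS⟩

/-- In particular the cross-model statement holds outright if alternative (1) does
(`EThr2LowerBound` unconditionally, a registered open problem of depth-two threshold circuit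
complexity: ECCC TR24-142, §1, "an open problem since 2010 to find super-polynomial lower bounds
for `ETHR ∘ ETHR` circuits [HP10, Wil18c]"). [folklore] -/
theorem ethr2_lower_bound_of_seth_of_eThr2LowerBound (h : EThr2LowerBound) :
    SETH → EThr2LowerBound :=
  fun _ => h

end Literature.Computability.FineGrained
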